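import Summits.HubbardSuperconductivity.HubbardSuperconductivity.Theorems.BalabanIRBirGappedPhaseReductionTorusModes
import Summits.HubbardSuperconductivity.HubbardSuperconductivity.Theorems.BalabanIRBirGappedPhaseReductionTwoStateDeterminant
import HarnessLib

/-!
# Route BalabanIR — crux 4 `BirGappedPhaseReduction` (item `stmt-HubbardSuperconductivity-2082`):
# zero-mode temporal coercivity of the BdG torus reference weight (assembly)

Dictionary step: the TEMPORAL half of hypothesis (C) of the engine, in the zero spatial mode, for the
route's quasi-free (BdG, `d+id`-type translation-invariant) reference weight — now an end-to-end
theorem about the actual Trotter DETERMINANT (= Fock weight by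
`Literature/…/BdGBondHamiltonianTrotterDeterminant`, only the phase jumps enter by
`Literature/…/BdGNambuMatrixPhaseRotation`, modes factorise by `…TorusModes`, one-mode bound
`…TwoStateDeterminant`, two-state coercivity `…TemporalCoercivity`).

* `twoState_gauge` — a Hermitian `2 × 2` matrix `G` is `v Ĝ vᴴ` with `v = diag(1, w)`, `|w| = 1`,
  `Ĝ = !![Re G₀₀, ‖G₁₀‖; ‖G₁₀‖, Re G₁₁]` REAL (entrywise nonnegative when `G ≥ 0`);
  `det_one_add_prod_map_diagonal_conj` — the diagonal gauge `v` commutes with the phase steps and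
  drops out of `det(1 + ∏ …)`; `twoState_norm_det_one_add_prod_le_of_isHermitian` — hence the one-mode
  bound of `…TwoStateDeterminant` holds for the Hermitian `G = e^{-ah_k}` itself;
* **`norm_det_one_add_prod_torusBdG_le`** — for `B = fromBlocks (circulant η) (circulant Δ) (circulant Δ)ᴴ (-circulant η)`
  with real hopping symbol, any step `a`, any CLOSED history of `k` Nambu phase pairs
  (`Σ(e+o) = 0`) and any admissible family `0 ≤ κ_k`:
  `‖det(1 + ∏_σ e^{-aB}U(e_σ) e^{-aB}U(o_σ))‖ ≤ ∏_k [1 + |det Ĝ_k|^{2k} + e^{-(κ_k/2)Σ_σ[(1-cos e_σ)+(1-cos o_σ)]} tr Ĝ_k^{2k}]`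
  — uniformly in the number of slices; `exists_admissible_family` (`κ_k > 0` at every mode whose
  `Ĝ_k` is entrywise positive, `gaugeFix_pos_iff`: iff the pair-hopping entry `(e^{-ah_k})₁₀ ≠ 0`,
  i.e. `Δ̂ k ≠ 0`, `a ≠ 0`).

Reading: in the zero spatial mode the reference weight of a slice-phase history is, mode by mode, a
phase-blind empty/broken-pair part `1 + det G_k^{2k}` (`det G_k = 1`) plus a pair part whose modulus
pays `e^{-(κ_k/2)(1 - cos δ)}` for EVERY misalignment between consecutive slices — the content of
keeping temporal pairs in (C) for the restated engine, with no degradation as `M → ∞`.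
`Theses`-free, no definitions; `--supports` the crux. [folklore]
-/

noncomputable section

namespace Summit.HubbardSuperconductivity.HubbardSuperconductivity.Theorems

namespace BirBdG

open Matrix NormedSpace Literature.Probability.LatticeModels
open scoped Matrix.Norms.Operator ComplexConjugate ComplexOrder

/-! ### Per-mode gauge fixing: a Hermitian `2 × 2` matrix is diagonally-unitarily real -/

section Gauge

/-- Entries of a diagonal unitary conjugate: `(v X vᴴ)ᵢⱼ = vᵢ Xᵢⱼ conj vⱼ`. [folklore] -/
theorem diagonal_mul_mul_conjTranspose_apply {n : Type*} [Fintype n] [DecidableEq n]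
    (d : n → ℂ) (X : Matrix n n ℂ) (i j : n) :
    (diagonal d * X * (diagonal d)ᴴ) i j = d i * X i j * star (d j) := by
  rw [diagonal_conjTranspose, mul_diagonal, diagonal_mul, Pi.star_apply]

/-- **Gauge fixing a Hermitian `2 × 2` matrix.** There is a phase `w` (`conj w · w = 1`) with
`G = v Ĝ vᴴ`, `v = diag(1, w)`, `Ĝ = !![Re G₀₀, ‖G₁₀‖; ‖G₁₀‖, Re G₁₁]` real symmetric with
nonnegative off-diagonal entries. [folklore] -/
theorem twoState_gauge {G : Matrix (Fin 2) (Fin 2) ℂ} (hG : G.IsHermitian) :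
    ∃ w : ℂ, star w * w = 1 ∧
      G = diagonal ![(1 : ℂ), w] *
        (!![(G 0 0).re, ‖G 1 0‖; ‖G 1 0‖, (G 1 1).re] : Matrix (Fin 2) (Fin 2) ℝ).map ((↑) : ℝ → ℂ) *
        (diagonal ![(1 : ℂ), w])ᴴ := by
  have h00 : ((G 0 0).re : ℂ) = G 0 0 := Complex.conj_eq_iff_re.mp (hG.apply 0 0)
  have h11 : ((G 1 1).re : ℂ) = G 1 1 := Complex.conj_eq_iff_re.mp (hG.apply 1 1)
  have h01 : G 0 1 = star (G 1 0) := (hG.apply 0 1).symm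
  -- the phase
  set z : ℂ := G 1 0 with hz
  set w : ℂ := if z = 0 then 1 else z / (‖z‖ : ℂ) with hw
  have hww : star w * w = 1 := by
    rw [hw]
    split_ifs with h
    · simp
    · have hn : ((‖z‖ : ℝ) : ℂ) ≠ 0 := by
        rw [Ne, Complex.ofReal_eq_zero, norm_eq_zero]; exact h
      rw [star_div₀, Complex.star_def, Complex.conj_ofReal, div_mul_div_comm,
        ← Complex.normSq_eq_conj_mul_self, Complex.normSq_eq_norm_sq]
      push_cast
      field_simp
  have hzw : w * (‖z‖ : ℂ) = z := by
    rw [hw]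
    split_ifs with h
    · rw [h, norm_zero, Complex.ofReal_zero, mul_zero]
    · have hn : ((‖z‖ : ℝ) : ℂ) ≠ 0 := by
        rw [Ne, Complex.ofReal_eq_zero, norm_eq_zero]; exact h
      exact div_mul_cancel₀ z hn
  have hwz : (‖z‖ : ℂ) * star w = star z := by
    have h := congrArg star hzw
    rw [star_mul', Complex.star_def, Complex.conj_ofReal] at h
    rw [Complex.star_def, mul_comm]
    exact h
  have hww' : w * star w = 1 := by rw [mul_comm]; exact hww
  refine ⟨w, hww, ?_⟩
  ext i j
  rw [diagonal_mul_mul_conjTranspose_apply, Matrix.map_apply]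
  fin_cases i <;> fin_cases j
  · simp [h00]
  · simp only [Fin.zero_eta, Fin.isValue, Fin.mk_one, Matrix.cons_val_zero, Matrix.of_apply,
      Matrix.cons_val', Matrix.cons_val_one, Matrix.cons_val_fin_one, Matrix.empty_val', one_mul]
    rw [h01, ← hwz]
  · simp only [Fin.mk_one, Fin.isValue, Fin.zero_eta, Matrix.cons_val_one, Matrix.cons_val_fin_one,
      Matrix.of_apply, Matrix.cons_val', Matrix.cons_val_zero, Matrix.empty_val', star_one, mul_one]
    exact hzw.symm
  · simp only [Fin.mk_one, Fin.isValue, Matrix.cons_val_one, Matrix.cons_val_fin_one, Matrix.of_apply,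
      Matrix.cons_val', Matrix.empty_val']
    rw [mul_right_comm, hww', one_mul, h11]

/-- Conjugating every factor by a diagonal unitary `v` (which commutes with the diagonal phase
steps) does not change the Trotter determinant: `det(1 + ∏ (vXvᴴ) D_x) = det(1 + ∏ X D_x)`.
[folklore] -/
theorem det_one_add_prod_map_diagonal_conj {α : Type*} (w : ℂ) (hw : star w * w = 1)
    (X : Matrix (Fin 2) (Fin 2) ℂ) (l : List α) (c : α → Fin 2 → ℂ) :
    (1 + (l.map fun x => diagonal ![(1 : ℂ), w] * X * (diagonal ![(1 : ℂ), w])ᴴ *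
        diagonal (c x)).prod).det =
      (1 + (l.map fun x => X * diagonal (c x)).prod).det := by
  set v : Matrix (Fin 2) (Fin 2) ℂ := diagonal ![(1 : ℂ), w] with hv
  have hww' : w * star w = 1 := by rw [mul_comm]; exact hw
  have hvv : v * vᴴ = 1 := by
    rw [hv, diagonal_conjTranspose, diagonal_mul_diagonal, ← diagonal_one]
    congr 1
    funext i
    fin_cases i
    · simp
    · simpa using hww'
  have hvv' : vᴴ * v = 1 := by
    rw [hv, diagonal_conjTranspose, diagonal_mul_diagonal, ← diagonal_one]
    congr 1
    funext i
    fin_cases i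
    · simp
    · simpa using hw
  -- `vᴴ` commutes with the diagonal steps
  have hcomm : ∀ x, vᴴ * diagonal (c x) = diagonal (c x) * vᴴ := fun x => by
    rw [hv, diagonal_conjTranspose, diagonal_mul_diagonal, diagonal_mul_diagonal]
    congr 1
    funext i
    exact mul_comm _ _
  have hfac : (l.map fun x => v * X * vᴴ * diagonal (c x)) =
      (l.map fun x => X * diagonal (c x)).map fun Y => v * Y * vᴴ := by
    rw [List.map_map]
    refine List.map_congr_left fun x _ => ?_
    show v * X * vᴴ * diagonal (c x) = v * (X * diagonal (c x)) * vᴴ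
    rw [Matrix.mul_assoc (v * X), hcomm, ← Matrix.mul_assoc, Matrix.mul_assoc v]
  -- telescoping
  have htel : ∀ l' : List (Matrix (Fin 2) (Fin 2) ℂ),
      (l'.map fun Y => v * Y * vᴴ).prod = v * l'.prod * vᴴ := by
    intro l'
    induction l' with
    | nil => rw [List.map_nil, List.prod_nil, Matrix.mul_one, hvv]
    | cons Y l' ih =>
      rw [List.map_cons, List.prod_cons, List.prod_cons, ih]
      simp only [Matrix.mul_assoc]
      rw [← Matrix.mul_assoc vᴴ v, hvv', Matrix.one_mul]
  rw [hfac, htel,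
    show (1 : Matrix (Fin 2) (Fin 2) ℂ) + v * (l.map fun x => X * diagonal (c x)).prod * vᴴ =
      v * (1 + (l.map fun x => X * diagonal (c x)).prod) * vᴴ by
      rw [Matrix.mul_add, Matrix.add_mul, Matrix.mul_one, hvv],
    det_mul, det_mul, mul_right_comm, ← det_mul, hvv, det_one, one_mul]

/-- Products of phase PAIRS are products over the interleaved list. [folklore] -/
theorem prod_map_pair_eq_prod_flatMap {R : Type*} [Monoid R] (Y : R) (Nf : ℝ → R)
    (ps : List (ℝ × ℝ)) :
    (ps.map fun p => Y * Nf p.1 * (Y * Nf p.2)).prod =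
      ((ps.flatMap fun p => [p.1, p.2]).map fun δ => Y * Nf δ).prod := by
  rw [List.map_flatMap]
  have h := prod_map_mul_eq_prod_flatMap (ps.map fun p => (Y * Nf p.1, Y * Nf p.2))
  rw [List.map_map, List.flatMap_map] at h
  exact h

/-- **Per-mode temporal coercivity of the Fock determinant, Hermitian transfer matrix.** For a
Hermitian `2 × 2` matrix `G` with nonnegative diagonal (e.g. `G = e^{-ah}`), its gauge-fixed real form
`Ĝ = !![Re G₀₀, ‖G₁₀‖; ‖G₁₀‖, Re G₁₁]`, any `0 ≤ κ` admissible for `Ĝ` (companion file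
`…TemporalCoercivity`), and a closed history of `k` Nambu phase pairs (`Σ(e+o) = 0`):
`‖det(1 + ∏_σ G u(e_σ) G u(o_σ))‖ ≤ 1 + |det Ĝ|^{2k} + e^{-(κ/2)Σ[(1-cos e)+(1-cos o)]} tr Ĝ^{2k}`.
[folklore] -/
theorem twoState_norm_det_one_add_prod_le_of_isHermitian {G : Matrix (Fin 2) (Fin 2) ℂ}
    (hG : G.IsHermitian) (h00 : 0 ≤ (G 0 0).re) (h11 : 0 ≤ (G 1 1).re)
    (Gr : Matrix (Fin 2) (Fin 2) ℝ) (hGr : Gr = !![(G 0 0).re, ‖G 1 0‖; ‖G 1 0‖, (G 1 1).re])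
    {κ : ℝ} (hκ0 : 0 ≤ κ)
    (hκ : ∀ b b' : Fin 2, κ * (Gr b 0 * Gr 0 b' + Gr b 1 * Gr 1 b') ^ 2 ≤ (Gr b 0 * Gr 0 b') * (Gr b 1 * Gr 1 b'))
    (ps : List (ℝ × ℝ)) (hsum : (ps.map fun p => p.1 + p.2).sum = 0) :
    ‖(1 + (ps.map fun p =>
        G * diagonal ![Complex.exp (((-(p.1 / 2) : ℝ) : ℂ) * Complex.I),
            Complex.exp (((p.1 / 2 : ℝ) : ℂ) * Complex.I)] *
        (G * diagonal ![Complex.exp (((-(p.2 / 2) : ℝ) : ℂ) * Complex.I),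
            Complex.exp (((p.2 / 2 : ℝ) : ℂ) * Complex.I)])).prod).det‖ ≤
      1 + |Gr.det| ^ (2 * ps.length) +
        Real.exp (-(κ / 2 * (ps.map fun p => (1 - Real.cos p.1) + (1 - Real.cos p.2)).sum)) *
          ((Gr * Gr) ^ ps.length).trace := by
  have hGr0 : ∀ i j, 0 ≤ Gr i j := by
    intro i j
    rw [hGr]
    fin_cases i <;> fin_cases j
    · exact h00
    · exact norm_nonneg (G 1 0)
    · exact norm_nonneg (G 1 0)
    · exact h11
  obtain ⟨w, hw, hGeq⟩ := twoState_gauge hG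
  rw [← hGr] at hGeq
  have hfacG : (fun δ : ℝ => G * diagonal ![Complex.exp (((-(δ / 2) : ℝ) : ℂ) * Complex.I),
      Complex.exp (((δ / 2 : ℝ) : ℂ) * Complex.I)]) =
      fun δ : ℝ => diagonal ![(1 : ℂ), w] * Gr.map ((↑) : ℝ → ℂ) * (diagonal ![(1 : ℂ), w])ᴴ *
        diagonal ![Complex.exp (((-(δ / 2) : ℝ) : ℂ) * Complex.I),
          Complex.exp (((δ / 2 : ℝ) : ℂ) * Complex.I)] := by
    funext δ
    rw [← hGeq]
  rw [prod_map_pair_eq_prod_flatMap G (fun δ => diagonal ![Complex.exp (((-(δ / 2) : ℝ) : ℂ) * Complex.I),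
      Complex.exp (((δ / 2 : ℝ) : ℂ) * Complex.I)]) ps, hfacG,
    det_one_add_prod_map_diagonal_conj w hw (Gr.map ((↑) : ℝ → ℂ)) _
      (fun δ : ℝ => ![Complex.exp (((-(δ / 2) : ℝ) : ℂ) * Complex.I), Complex.exp (((δ / 2 : ℝ) : ℂ) * Complex.I)]),
    ← prod_map_pair_eq_prod_flatMap (Gr.map ((↑) : ℝ → ℂ)) (fun δ => diagonal
      ![Complex.exp (((-(δ / 2) : ℝ) : ℂ) * Complex.I), Complex.exp (((δ / 2 : ℝ) : ℂ) * Complex.I)]) ps]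
  exact twoState_norm_det_one_add_prod_le Gr hGr0 hκ0 hκ ps hsum

end Gauge

/-! ### The zero-mode temporal coercivity of the BdG torus reference weight -/

section Final

variable {L : ℕ} [NeZero L]

/-- The symbol blocks `h_k = !![η̂ k, Δ̂ k; conj Δ̂ k, -η̂ k]` are Hermitian when the hopping symbol is
real. [folklore] -/
theorem isHermitian_symbolBlock {ξ D : ℂ} (hξ : star ξ = ξ) :
    (!![ξ, D; star D, -ξ] : Matrix (Fin 2) (Fin 2) ℂ).IsHermitian := by
  refine Matrix.IsHermitian.ext fun i j => ?_
  fin_cases i <;> fin_cases j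
  · simpa using hξ
  · simp
  · simp
  · simp [hξ]

/-- **Zero-mode temporal coercivity of the BdG torus reference weight (Trotter determinant).**
Translation-invariant BdG block data `B = fromBlocks (circulant η) (circulant Δ) (circulant Δ)ᴴ (-circulant η)`
on `(ℤ/L)² ⊕ (ℤ/L)²` with real hopping symbol, step `a`, and a CLOSED slice-constant pair-phase
history written as `k` pairs of Nambu phase steps `U(δ) = diag(e^{-iδ/2}·1, e^{+iδ/2}·1)`,
`Σ_σ (e_σ + o_σ) = 0`. With `G_k = e^{-a h_k}`, `h_k = !![η̂ k, Δ̂ k; conj Δ̂ k, -η̂ k]`, the gauge-fixed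
real forms `Ĝ_k = !![Re (G_k)₀₀, ‖(G_k)₁₀‖; ‖(G_k)₁₀‖, Re (G_k)₁₁]` and ANY family `0 ≤ κ_k`
admissible for `Ĝ_k` (four conditional-variance inequalities, `…TemporalCoercivity`):
`‖det(1 + ∏_σ e^{-aB}U(e_σ) e^{-aB}U(o_σ))‖ ≤ ∏_k [1 + |det Ĝ_k|^{2k} + e^{-(κ_k/2) Σ_σ[(1-cos e_σ)+(1-cos o_σ)]} tr Ĝ_k^{2k}]`
— every mode's pair sector pays `e^{-(κ_k/2)(1 - cos δ)}` for EVERY phase misalignment between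
consecutive slices, uniformly in the number of slices; the phase-blind part per mode is the
empty/broken-pair sector `1 + det G_k^{2k}` (`det G_k = 1`, `tr G_k^{2k} = 2cosh(2k·aE_k)`). With the
Trotter determinant formula (`Literature/…/BdGBondHamiltonianTrotterDeterminant`), the gauge
telescoping (`Literature/…/BdGNambuMatrixPhaseRotation`) and the transport
`bdgNambuMatrix_transport_eq_reindex_fromBlocks` this is the temporal half of hypothesis (C) for the
route's reference weight in the zero spatial mode. [folklore] -/
theorem norm_det_one_add_prod_torusBdG_le (η Δv : TorusSite 2 L → ℂ)
    (hη : ∀ k, star (torusFourier η k) = torusFourier η k) (a : ℝ)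
    (ps : List (ℝ × ℝ)) (hsum : (ps.map fun p => p.1 + p.2).sum = 0)
    (Gr : TorusSite 2 L → Matrix (Fin 2) (Fin 2) ℝ)
    (hGr : ∀ k, Gr k =
      !![(Matrix.gibbsWeight a (!![torusFourier η k, torusFourier Δv k;
            star (torusFourier Δv k), -torusFourier η k] : Matrix (Fin 2) (Fin 2) ℂ) 0 0).re,
          ‖Matrix.gibbsWeight a (!![torusFourier η k, torusFourier Δv k;
            star (torusFourier Δv k), -torusFourier η k] : Matrix (Fin 2) (Fin 2) ℂ) 1 0‖;
        ‖Matrix.gibbsWeight a (!![torusFourier η k, torusFourier Δv k;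
            star (torusFourier Δv k), -torusFourier η k] : Matrix (Fin 2) (Fin 2) ℂ) 1 0‖,
          (Matrix.gibbsWeight a (!![torusFourier η k, torusFourier Δv k;
            star (torusFourier Δv k), -torusFourier η k] : Matrix (Fin 2) (Fin 2) ℂ) 1 1).re])
    (κ : TorusSite 2 L → ℝ) (hκ0 : ∀ k, 0 ≤ κ k)
    (hκ : ∀ k (b b' : Fin 2), κ k * (Gr k b 0 * Gr k 0 b' + Gr k b 1 * Gr k 1 b') ^ 2 ≤
      (Gr k b 0 * Gr k 0 b') * (Gr k b 1 * Gr k 1 b')) :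
    ‖(1 + (ps.map fun p : ℝ × ℝ =>
        Matrix.gibbsWeight a (fromBlocks (circulant η) (circulant Δv) (circulant Δv)ᴴ (-circulant η)) *
          fromBlocks (Complex.exp (((-(p.1 / 2) : ℝ) : ℂ) * Complex.I) •
              (1 : Matrix (TorusSite 2 L) (TorusSite 2 L) ℂ)) 0 0
            (Complex.exp (((p.1 / 2 : ℝ) : ℂ) * Complex.I) • 1) *
        (Matrix.gibbsWeight a (fromBlocks (circulant η) (circulant Δv) (circulant Δv)ᴴ (-circulant η)) *
          fromBlocks (Complex.exp (((-(p.2 / 2) : ℝ) : ℂ) * Complex.I) •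
              (1 : Matrix (TorusSite 2 L) (TorusSite 2 L) ℂ)) 0 0
            (Complex.exp (((p.2 / 2 : ℝ) : ℂ) * Complex.I) • 1))).prod).det‖ ≤
      ∏ k : TorusSite 2 L, (1 + |(Gr k).det| ^ (2 * ps.length) +
        Real.exp (-(κ k / 2 * (ps.map fun p => (1 - Real.cos p.1) + (1 - Real.cos p.2)).sum)) *
          ((Gr k * Gr k) ^ ps.length).trace) := by
  have hh : ∀ k, (!![torusFourier η k, torusFourier Δv k; star (torusFourier Δv k), -torusFourier η k] :
      Matrix (Fin 2) (Fin 2) ℂ).IsHermitian := fun k => isHermitian_symbolBlock (hη k)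
  rw [prod_map_pair_eq_prod_flatMap
      (Matrix.gibbsWeight a (fromBlocks (circulant η) (circulant Δv) (circulant Δv)ᴴ (-circulant η)))
      (fun δ : ℝ => fromBlocks (Complex.exp (((-(δ / 2) : ℝ) : ℂ) * Complex.I) •
          (1 : Matrix (TorusSite 2 L) (TorusSite 2 L) ℂ)) 0 0
        (Complex.exp (((δ / 2 : ℝ) : ℂ) * Complex.I) • 1)) ps,
    det_one_add_prod_torusBdG_eq_prod_modes, norm_prod]
  refine Finset.prod_le_prod (fun k _ => norm_nonneg _) fun k _ => ?_
  rw [← prod_map_pair_eq_prod_flatMap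
      (Matrix.gibbsWeight a (!![torusFourier η k, torusFourier Δv k;
          star (torusFourier Δv k), -torusFourier η k] : Matrix (Fin 2) (Fin 2) ℂ))
      (fun δ : ℝ => diagonal ![Complex.exp (((-(δ / 2) : ℝ) : ℂ) * Complex.I),
        Complex.exp (((δ / 2 : ℝ) : ℂ) * Complex.I)]) ps]
  have hG := isHermitian_gibbsWeight a (hh k)
  have hPSD := (posDef_gibbsWeight a (hh k)).posSemidef
  exact twoState_norm_det_one_add_prod_le_of_isHermitian hG (Complex.nonneg_iff.mp hPSD.diag_nonneg).1
    (Complex.nonneg_iff.mp hPSD.diag_nonneg).1 (Gr k) (hGr k) (hκ0 k) (hκ k) ps hsum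

/-- **Admissible coercivity constants exist**, positive at every mode whose gauge-fixed transfer
matrix is entrywise positive (the minimum of the four conditional variances,
`twoState_exists_conditionalVariance`); `κ_k = 0` is always admissible. [folklore] -/
theorem exists_admissible_family {m : Type*} (Gr : m → Matrix (Fin 2) (Fin 2) ℝ)
    (hGr0 : ∀ k i j, 0 ≤ Gr k i j) :
    ∃ κ : m → ℝ, (∀ k, 0 ≤ κ k) ∧ (∀ k, (∀ i j, 0 < Gr k i j) → 0 < κ k) ∧
      ∀ k (b b' : Fin 2), κ k * (Gr k b 0 * Gr k 0 b' + Gr k b 1 * Gr k 1 b') ^ 2 ≤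
        (Gr k b 0 * Gr k 0 b') * (Gr k b 1 * Gr k 1 b') := by
  classical
  refine ⟨fun k => if h : ∀ i j, 0 < Gr k i j then
      Classical.choose (twoState_exists_conditionalVariance (Gr k) h) else 0, ?_, ?_, ?_⟩
  · intro k
    dsimp only
    by_cases h : ∀ i j, 0 < Gr k i j
    · rw [dif_pos h]; exact (Classical.choose_spec (twoState_exists_conditionalVariance (Gr k) h)).1.le
    · rw [dif_neg h]
  · intro k h
    dsimp only
    rw [dif_pos h]
    exact (Classical.choose_spec (twoState_exists_conditionalVariance (Gr k) h)).1
  · intro k b b'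
    dsimp only
    by_cases h : ∀ i j, 0 < Gr k i j
    · rw [dif_pos h]
      exact (Classical.choose_spec (twoState_exists_conditionalVariance (Gr k) h)).2 b b'
    · rw [dif_neg h, zero_mul]
      exact mul_nonneg (mul_nonneg (hGr0 k b 0) (hGr0 k 0 b')) (mul_nonneg (hGr0 k b 1) (hGr0 k 1 b'))

/-- **When is a mode coercive?** The gauge-fixed form of a Hermitian `2 × 2` Gibbs weight is entrywise
POSITIVE iff its off-diagonal (pair-hopping) entry is nonzero — the diagonal entries are positive by
positive definiteness. [folklore] -/
theorem gaugeFix_pos_iff {h : Matrix (Fin 2) (Fin 2) ℂ} (hh : h.IsHermitian) (a : ℝ) :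
    (∀ i j, 0 < (!![(Matrix.gibbsWeight a h 0 0).re, ‖Matrix.gibbsWeight a h 1 0‖;
        ‖Matrix.gibbsWeight a h 1 0‖, (Matrix.gibbsWeight a h 1 1).re] : Matrix (Fin 2) (Fin 2) ℝ) i j) ↔
      Matrix.gibbsWeight a h 1 0 ≠ 0 := by
  have hPD := posDef_gibbsWeight a hh
  have h00 : 0 < (Matrix.gibbsWeight a h 0 0).re := (Complex.pos_iff.mp (hPD.diag_pos (i := 0))).1
  have h11 : 0 < (Matrix.gibbsWeight a h 1 1).re := (Complex.pos_iff.mp (hPD.diag_pos (i := 1))).1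
  constructor
  · intro H
    have := H 1 0
    simp only [Matrix.of_apply, Matrix.cons_val', Matrix.cons_val_zero, Matrix.cons_val_one,
      Matrix.cons_val_fin_one, Matrix.empty_val', norm_pos_iff] at this
    exact this
  · intro H i j
    fin_cases i <;> fin_cases j
    · exact h00
    · exact norm_pos_iff.mpr H
    · exact norm_pos_iff.mpr H
    · exact h11

end Final

end BirBdG

end Summit.HubbardSuperconductivity.HubbardSuperconductivity.Theorems
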